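import Mathlib

/-!
# Rung 0 of (GD₀) at the η-momentum: two bosons with on-site repulsion, every coupling

Conjunct `BoseEinsteinCondensation` of `AtomisticToContinuum` — soloist report `paper/sharpest.md`
§4.10(viii′).  For two bosons on the torus `Λ = (ℤ/Lℤ)^d` with nearest-neighbour hopping
(one-particle dispersion `ε(q) = Σᵢ 2(1 − cos qᵢ) ∈ [0, 4d]`) and on-site repulsion `U ≥ 0`
(Bose–Hubbard, `v̂ ≡ U`: positive type for every `U`, hard core at `U = ∞`), the particle-addition
susceptibility of the report at the η-momentum `k = (π,…,π)` is EXACTLY computable, because the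
two-particle kinetic energy is constant on the sector of total momentum `k`
(`ε(k/2 + q) + ε(k/2 − q) = 4d` for every `q`), so that `H₂ = 4d + U |η⟩⟨η|` there, `η` the
doublon state of momentum `k`, and `|⟨η, a_k† Ψ₀^{(1)}⟩|² = 2/|Λ|`:

  `χ₊(k) = (1 − 2/|Λ|)/(4d − E₂) + (2/|Λ|)/(4d + U − E₂)`,   `E₂ := E₀(N = 2) ∈ [0, 4d)`

(checked against dense two-boson diagonalisation to `10⁻¹⁶`, `work/s18`).  The two-boson ground
energy solves the secular equation `1/U = |Λ|⁻¹ [1/E₂ + Σ_{q ≠ 0} 1/(E₂ − 2ε(q))]`, whence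
`E₂ |Λ| (1 + U W) ≤ U` with `W := (2|Λ|)⁻¹ Σ_{q≠0} 1/ε(q)` (half the zero-momentum-removed lattice
Green's function at the origin; `W = (L² − 1)/(24 L)` for `d = 1`, `→ 0.126…` for `d = 3`).

This file is the real-arithmetic kernel: the closed form, the secular bound and `8 d W ≥ 1`
(true for `d = 1, L ≥ 4`; for `d = 2, 3` and all `L` large enough) imply free-constant Gaussian
domination `χ₊(k) ε(k) ≤ 1` at the η-momentum for EVERY `U ≥ 0` — rung 0 of conjecture (GD₀)
decided at the momentum where, in `d = 1`, the `N`-body bound is tightest (`χ₊ε → 1 − 2ν` as the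
filling `ν → 0`, s18).  Equality holds iff `U = 0` or `E₂ = 0`.

* `SoloInformed.eta_key` — the criterion form: `4dχ ≤ 1 ⟸ E₂ |Λ| (4d + U − E₂) ≤ 8 d U`;
* `SoloInformed.eta_secular_criterion` — the secular bound and `8dW ≥ 1` give that criterion;
* `SoloInformed.eta_twoBody_domination` — the composition.
-/

namespace Summit.AtomisticToContinuum.BoseEinsteinCondensation.Theorems
namespace SoloInformed

/-- Criterion form of two-body Gaussian domination at the η-momentum: with
`χ = (1 − 2/V)/(4d − E) + (2/V)/(4d + U − E)`, `E < 4d`, `0 ≤ U`, `0 < V`,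
the inequality `E·V·(4d + U − E) ≤ 8 d U` implies `4 d χ ≤ 1`. -/
theorem eta_key (d V U E χ : ℝ) (hV : 0 < V) (hU : 0 ≤ U) (hE4 : E < 4 * d)
    (hχ : χ = (1 - 2 / V) / (4 * d - E) + (2 / V) / (4 * d + U - E))
    (hkey : E * V * (4 * d + U - E) ≤ 8 * d * U) :
    4 * d * χ ≤ 1 := by
  have hD1 : 0 < 4 * d - E := by linarith
  have hD2 : 0 < 4 * d + U - E := by linarith
  have hχ' : χ = (V * (4 * d + U - E) - 2 * U) / (V * (4 * d - E) * (4 * d + U - E)) := by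
    rw [hχ]
    field_simp
    ring
  rw [hχ']
  have hpos : 0 < V * (4 * d - E) * (4 * d + U - E) := by positivity
  rw [← sub_nonneg]
  have : 1 - 4 * d * ((V * (4 * d + U - E) - 2 * U) / (V * (4 * d - E) * (4 * d + U - E)))
      = (8 * d * U - E * V * (4 * d + U - E)) / (V * (4 * d - E) * (4 * d + U - E)) := by
    field_simp
    ring
  rw [this]
  apply div_nonneg _ hpos.le
  linarith

/-- The secular bound `E·V·(1 + U W) ≤ U` together with `8 d W ≥ 1` gives the criterion. -/
theorem eta_secular_criterion (d V U E W : ℝ) (hd : 0 < d) (hV : 0 < V) (hU : 0 ≤ U)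
    (hE : 0 ≤ E) (hW : 1 ≤ 8 * d * W) (hsec : E * V * (1 + U * W) ≤ U) :
    E * V * (4 * d + U - E) ≤ 8 * d * U := by
  have hEV : 0 ≤ E * V := mul_nonneg hE hV.le
  have h1 : E * V * (4 * d + U - E) ≤ E * V * (4 * d + U) := by nlinarith
  have h2 : 4 * d + U ≤ 8 * d * (1 + U * W) := by nlinarith
  have h3 : E * V * (4 * d + U) ≤ E * V * (8 * d * (1 + U * W)) :=
    mul_le_mul_of_nonneg_left h2 hEV
  have h4 : E * V * (8 * d * (1 + U * W)) = 8 * d * (E * V * (1 + U * W)) := by ring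
  have h5 : 8 * d * (E * V * (1 + U * W)) ≤ 8 * d * U :=
    mul_le_mul_of_nonneg_left hsec (by linarith)
  linarith

/-- Rung 0 of (GD₀) at the η-momentum for every on-site coupling `U ≥ 0`:
closed form + secular bound + `8 d W ≥ 1` imply `χ₊(k) ε(k) = 4 d χ ≤ 1`. -/
theorem eta_twoBody_domination (d V U E W χ : ℝ) (hd : 0 < d) (hV : 0 < V) (hU : 0 ≤ U)
    (hE : 0 ≤ E) (hE4 : E < 4 * d) (hW : 1 ≤ 8 * d * W) (hsec : E * V * (1 + U * W) ≤ U)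
    (hχ : χ = (1 - 2 / V) / (4 * d - E) + (2 / V) / (4 * d + U - E)) :
    4 * d * χ ≤ 1 :=
  eta_key d V U E χ hV hU hE4 hχ (eta_secular_criterion d V U E W hd hV hU hE hW hsec)

/-- The `d = 1` constant: `W = (L² − 1)/(24 L)` satisfies `8 W ≥ 1` as soon as `L ≥ 4`. -/
theorem eta_ring_constant (L : ℝ) (hL : 4 ≤ L) : 1 ≤ 8 * 1 * ((L ^ 2 - 1) / (24 * L)) := by
  have hLpos : 0 < 24 * L := by linarith
  rw [show 8 * 1 * ((L ^ 2 - 1) / (24 * L)) = (8 * (L ^ 2 - 1)) / (24 * L) by ring]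
  rw [le_div_iff₀ hLpos]
  nlinarith

end SoloInformed
end Summit.AtomisticToContinuum.BoseEinsteinCondensation.Theorems
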